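import Summits.ResolutionOfSingularities.ResolutionOfSingularities.Theorems.UniversalCellsProductDescentComponentsClopen
import Literature.AlgebraicGeometry.Morphisms.IsoOverOpen
import Literature.AlgebraicGeometry.Resolution.QuasiProjectiveResolution
import Mathlib.AlgebraicGeometry.Morphisms.IsIso
import Literature.AlgebraicGeometry.Limits.LocalizationIsoSpread
import Mathlib.AlgebraicGeometry.FunctionField
import Mathlib.AlgebraicGeometry.Morphisms.FlatDescent
import Mathlib.AlgebraicGeometry.Noetherian
import Mathlib.RingTheory.Spectrum.Prime.Jacobson
import Mathlib.RingTheory.Jacobson.Ring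
import Mathlib.FieldTheory.IsAlgClosed.Basic
import Literature.AlgebraicGeometry.Morphisms.NagataCompactificationProofs
import HarnessLib

/-!
# Crux `PrimeModelTransfer` (stmt-ResolutionOfSingularities-8933), door 2 of slot W8.2:
# lemmas for the SPECIALIZATION of resolutions (the downward prime-model transfer)

Route `ResolutionOfSingularities/UniformComplexity`, crux `PrimeModelTransfer` (resolution over the
algebraically closed fields algebraic over `𝔽_p` ⇒ resolution over every algebraically closed field
of characteristic `p`). The crux is the UPWARD transfer (prime model ⇒ all models); this file and
its sequel `UniformComplexityPrimeModelTransferSpecialization.lean` prove the DOWNWARD transfer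
— for `K ⊆ K⁺` with `K` algebraically closed and `K⁺` perfect, resolution of all integral
separated finite-type `K⁺`-schemes implies the same over `K` — by spreading a resolution of
`X ×_K K⁺` out over a finitely generated `K`-subalgebra of `K⁺` and specialising it at a
`K`-rational closed point (the "Lefschetz principle" direction; EGA IV₃ 8.8.2, 8.10.5, IV₄ 17.7.8).
With it, door 2 becomes a statement about ONE field and its residual ladder
`R_n := Res((𝔽_p(t₁,…,t_n))^{alg})` becomes monotone (see the sequel and
`UniformComplexityCampaignW82SpecializationLinks.lean`).

THIS FILE (Theses-free helper lemmas, each used by the sequel):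

* `hasResolution_of_isIso_morphismRestrict` — a proper `g : Y → X` from a regular Noetherian `Y`
  to an irreducible `X` which is an isomorphism over a non-empty open `W ⊆ X` yields a resolution
  of `X` (restrict to the clopen irreducible component of `Y` through `g⁻¹(W)`; components of a
  scheme with integral local rings are clopen, `ProductDescent.Birth.stub_componentsClopen`);
* `isIso_pullback_snd_fromSpecStalk_of_isIso_morphismRestrict`,
  `isIso_pullback_snd_fromSpecStalk_genericPoint_of_isPullback` — "isomorphism over an open
  containing the generic point" passes to "isomorphism after base change to `Spec K(X)`", and
  DESCENDS along a cartesian square `X → X'` mapping generic point to generic point (fpqc descent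
  of isomorphisms along the field extension `K(X') → K(X)`, Mathlib
  `descendsAlong_isomorphisms_surjective_inf_flat_inf_quasicompact`);
* `exists_isIso_morphismRestrict_of_isIso_pullback_snd_fromSpecStalk` — conversely an isomorphism
  over `Spec K(X)` SPREADS to an isomorphism over a non-empty open (Görtz–Wedhorn I Cor. 10.64 (2)
  for the localization diagram of an affine neighbourhood of the generic point, tree
  `Limits.LocApprox.exists_pullback_iso_of_pullback_iso`);
* `exists_isMaximal_mem_of_isOpen` — a non-empty open of `Spec R`, `R` of finite type over an
  algebraically closed `K`, contains a closed point with residue field `K` (Jacobson +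
  Zariski's lemma, Mathlib);
* `hasResolution_of_forall_proper` — it suffices to resolve PROPER integral `K`-schemes (Nagata's
  compactification theorem, PROVED in the tree: `Morphisms.NagataCompactification_holds`, plus
  `Scheme.HasResolution.of_isOpenImmersion`).

[OURS · LADDER-RESOLUTION L1, slot W8.2 (prime-field / universality transfer), door 2
UniformComplexity] Helper lemmas over the summit's own route; they are NOT statements of, and
attribute nothing to, Hironaka's 2017 manuscript. AI-written; weaker than expert review.
Barrier bookkeeping: nothing here base-changes a resolution along an inseparable field
extension; the only descent is of the property "isomorphism" along a faithfully flat map.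

Sources: A. Grothendieck, J. Dieudonné, EGA IV₃ (1966) Thm. 8.8.2, 8.10.5; U. Görtz, T. Wedhorn,
*Algebraic Geometry I* (2nd ed. 2020) Cor. 10.64; B. Conrad, *Deligne's notes on Nagata
compactifications* (2007) Thm. 4.1; The Stacks Project, Tags 01ZC, 02L4, 0F41.
[cite: GortzWedhorn2020, Cor. 10.64 (2)] [cite: EGAIV3, Thm. 8.10.5] [cite: Conrad2007, Thm. 4.1]
-/

noncomputable section

set_option linter.dupNamespace false -- mandated namespace of this single-conjunct summit

open CategoryTheory CategoryTheory.Limits AlgebraicGeometry TopologicalSpace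
open Literature.AlgebraicGeometry.Resolution

namespace Summit.ResolutionOfSingularities.ResolutionOfSingularities.Theorems.PrimeModelTransfer

/-- **A proper morphism from a regular Noetherian scheme which is an isomorphism over a non-empty
open subset of an irreducible target yields a resolution of the target.** Let `g : Y → X` be
proper with `Y` regular and Noetherian (as a topological space) and `X` irreducible, and let
`W ⊆ X` be a non-empty open over which `g` restricts to an isomorphism. Then `X` has a
resolution of singularities: the irreducible component `C` of `Y` containing the irreducible open
`g⁻¹(W) ≅ W` is open and closed (the local rings of `Y` are domains), so `C ↪ Y → X` is proper,
`C` is regular, and it is an isomorphism over the dense open `W`, whose preimage `g⁻¹(W) ⊆ C` is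
a non-empty open of the irreducible `C`, hence dense. [folklore] -/
theorem hasResolution_of_isIso_morphismRestrict {Y X : Scheme.{0}} (g : Y ⟶ X) [IsProper g]
    [IrreducibleSpace X] [NoetherianSpace Y] (hY : Scheme.IsRegular Y)
    (W : X.Opens) (hW : (W : Set X).Nonempty) [hiso : IsIso (g ∣_ W)] :
    Scheme.HasResolution X := by
  classical
  -- the open `V = g⁻¹(W) ≅ W` is non-empty and irreducible
  let V : Y.Opens := g ⁻¹ᵁ W
  have hWirr : IsIrreducible (W : Set X) :=
    ⟨hW, (IrreducibleSpace.isIrreducible_univ X).isPreirreducible.open_subset W.isOpen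
      (Set.subset_univ _)⟩
  haveI : IrreducibleSpace (W : Scheme.{0}) := Subtype.irreducibleSpace hWirr
  haveI : IrreducibleSpace (V : Scheme.{0}) :=
    (inv (g ∣_ W)).continuous |> Function.Surjective.irreducibleSpace
      (f := (inv (g ∣_ W) : _)) <| (inv (g ∣_ W)).surjective
  have hVirr : IsIrreducible (V : Set Y) := by
    have h := (IrreducibleSpace.isIrreducible_univ (V : Scheme.{0})).image _
      V.ι.continuous.continuousOn
    rwa [Set.image_univ, Scheme.Opens.range_ι] at h
  obtain ⟨v₀, hv₀⟩ : (V : Set Y).Nonempty := hVirr.nonempty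
  -- an irreducible component `D ⊇ V` of `Y`; it is open and closed
  obtain ⟨D, hDirr, hVD, hDmax⟩ := exists_preirreducible (V : Set Y) hVirr.isPreirreducible
  have hD : IsIrreducible D := ⟨⟨v₀, hVD hv₀⟩, hDirr⟩
  have hDmem : D ∈ irreducibleComponents (Y : Type) :=
    ⟨hD, fun u hu hDu => (hDmax u hu.isPreirreducible hDu).subset⟩
  have hclopen : IsClopen D :=
    ProductDescent.Birth.stub_componentsClopen Y inferInstance
      (fun y => by haveI := hY y; exact isDomain_of_isRegularLocalRing _) D hDmem
  let UD : Y.Opens := ⟨D, hclopen.isOpen⟩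
  haveI : IrreducibleSpace (UD : Scheme.{0}) := Subtype.irreducibleSpace hD
  -- `C := UD ↪ Y` is a closed immersion, so `ρ := C → Y → X` is proper; `C` is regular
  haveI : IsClosedImmersion UD.ι :=
    IsClosedImmersion.of_isPreimmersion UD.ι (by rw [Scheme.Opens.range_ι]; exact hclopen.isClosed)
  let ρ : (UD : Scheme.{0}) ⟶ X := UD.ι ≫ g
  haveI : IsProper ρ := inferInstance
  have hreg : Scheme.IsRegular (UD : Scheme.{0}) := hY.of_isOpenImmersion UD.ι
  -- `ρ` is an isomorphism over `W`: `UD.ι` is an isomorphism over `V = g⁻¹(W) ⊆ D`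
  haveI : IsIso (UD.ι ∣_ V) := by
    rw [isIso_iff_isOpenImmersion_and_surjective]
    refine ⟨inferInstance, ⟨fun x => ?_⟩⟩
    refine ⟨⟨⟨x.1, hVD x.2⟩, show UD.ι ⟨x.1, hVD x.2⟩ ∈ V from x.2⟩, ?_⟩
    apply Subtype.ext
    rw [morphismRestrict_base_coe]
    rfl
  haveI : IsIso (ρ ∣_ W) := Literature.AlgebraicGeometry.Morphisms.isIso_morphismRestrict_comp UD.ι g W
  -- birationality: `W` is dense, and `ρ⁻¹(W) = V ∩ D = V` is a non-empty open of the irreducible `C`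
  have hWd : Dense (W : Set X) := W.2.dense hW
  have hpre : Dense ((ρ ⁻¹ᵁ W : (UD : Scheme.{0}).Opens) : Set (UD : Scheme.{0})) := by
    refine (ρ ⁻¹ᵁ W).2.dense ⟨⟨v₀, hVD hv₀⟩, ?_⟩
    show ρ ⟨v₀, hVD hv₀⟩ ∈ W
    change g (UD.ι ⟨v₀, hVD hv₀⟩) ∈ W
    exact hv₀
  exact ⟨UD, ρ, ⟨inferInstance, ⟨W, hWd, hpre, inferInstance⟩, hreg⟩⟩

/-! ## Isomorphism at the generic point -/

/-- If `a : Y → X` restricts to an isomorphism over an open `U ∋ x`, then the base change of `a`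
along `Spec 𝒪_{X,x} → X` is an isomorphism (that map factors through `U`). [folklore] -/
theorem isIso_pullback_snd_fromSpecStalk_of_isIso_morphismRestrict {Y X : Scheme.{0}} (a : Y ⟶ X)
    (U : X.Opens) {x : X} (hx : x ∈ U) [IsIso (a ∣_ U)] :
    IsIso (pullback.snd a (X.fromSpecStalk x)) := by
  -- `Spec 𝒪_{X,x} → X` factors through `U`
  let l := U.fromSpecStalkOfMem x hx
  have hl : X.fromSpecStalk x = l ≫ U.ι := (Scheme.Opens.fromSpecStalkOfMem_ι U x hx).symm
  -- the base change of `a` along `U ↪ X` is `a|_U`, an isomorphism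
  haveI : IsIso (pullback.snd a U.ι) := by
    rw [← pullbackRestrictIsoRestrict_hom_morphismRestrict]
    infer_instance
  haveI : IsIso (pullback.snd a (l ≫ U.ι)) := by
    rw [← pullbackLeftPullbackSndIso_inv_snd_snd a U.ι l]
    infer_instance
  have e : pullback.snd a (X.fromSpecStalk x) =
      (pullback.congrHom rfl hl).hom ≫ pullback.snd a (l ≫ U.ι) := by
    rw [pullback.congrHom_hom, pullback.lift_snd, Category.comp_id]
  rw [e]
  infer_instance

/-- **fpqc descent of "isomorphism at the generic point" along a base change.** Let
`a : Y → X` be the base change of `G : Y' → X'` along `ℓ : X → X'` (a cartesian square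
`IsPullback πY a G ℓ`), with `X`, `X'` integral and `ℓ` mapping the generic point `ξ` of `X` to
the generic point `ξ'` of `X'`. If `a` restricts to an isomorphism over an open `U ∋ ξ`, then the
base change of `G` along `Spec 𝒪_{X',ξ'} = Spec K(X') → X'` is an isomorphism: the base change
of `G` along `Spec K(X) → Spec K(X') → X'` is that of `a` along `Spec K(X) → X`, an isomorphism,
and `Spec K(X) → Spec K(X')` is flat, surjective and quasi-compact, along which isomorphisms
descend (Mathlib's fpqc descent of isomorphisms). [folklore] -/
theorem isIso_pullback_snd_fromSpecStalk_genericPoint_of_isPullback {Y X Y' X' : Scheme.{0}}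
    [IsIntegral X] [IsIntegral X'] {πY : Y ⟶ Y'} {a : Y ⟶ X} {G : Y' ⟶ X'} {ℓ : X ⟶ X'}
    (H : IsPullback πY a G ℓ) (hℓ : ℓ (genericPoint X) = genericPoint X')
    (U : X.Opens) (hU : genericPoint X ∈ U) [IsIso (a ∣_ U)] :
    IsIso (pullback.snd G (X'.fromSpecStalk (genericPoint X'))) := by
  -- reduce to the point `ℓ ξ`, keeping only that its local ring is a field
  suffices key : ∀ x' : X', ℓ (genericPoint X) = x' → IsField (X'.presheaf.stalk x') →
      IsIso (pullback.snd G (X'.fromSpecStalk x')) from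
    key _ hℓ (Field.toIsField X'.functionField)
  intro x' hx' hF
  subst hx'
  set ξ := genericPoint X with hξ
  -- the base change of `a` along `Spec K(X) → X` is an isomorphism
  haveI h1 : IsIso (pullback.snd a (X.fromSpecStalk ξ)) :=
    isIso_pullback_snd_fromSpecStalk_of_isIso_morphismRestrict a U hU
  -- hence so is the base change of `G` along `Spec K(X) → X → X'`
  haveI h2 : IsIso (pullback.snd G (X.fromSpecStalk ξ ≫ ℓ)) := by
    -- `pullback G (φ ≫ ℓ) = pullback a φ` since `a` is the base change of `G` along `ℓ`
    have hP : IsPullback (pullback.fst a (X.fromSpecStalk ξ) ≫ πY)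
        (pullback.snd a (X.fromSpecStalk ξ)) G (X.fromSpecStalk ξ ≫ ℓ) :=
      (IsPullback.of_hasPullback a (X.fromSpecStalk ξ)).paste_horiz H
    rw [← hP.isoPullback_inv_snd]
    infer_instance
  -- rewrite `Spec K(X) → X → X'` as `Spec K(X) → Spec 𝒪_{X',ℓ ξ} → X'`
  let φ := ℓ.stalkMap ξ
  have hfac : X.fromSpecStalk ξ ≫ ℓ = Spec.map φ ≫ X'.fromSpecStalk (ℓ ξ) :=
    (Scheme.SpecMap_stalkMap_fromSpecStalk ℓ).symm
  haveI h3 : IsIso (pullback.snd (pullback.snd G (X'.fromSpecStalk (ℓ ξ))) (Spec.map φ)) := by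
    rw [← pullbackLeftPullbackSndIso_hom_snd G (X'.fromSpecStalk (ℓ ξ)) (Spec.map φ)]
    have e : pullback.snd G (Spec.map φ ≫ X'.fromSpecStalk (ℓ ξ)) =
        (pullback.congrHom rfl hfac.symm).hom ≫ pullback.snd G (X.fromSpecStalk ξ ≫ ℓ) := by
      rw [pullback.congrHom_hom, pullback.lift_snd, Category.comp_id]
    haveI : IsIso (pullback.snd G (Spec.map φ ≫ X'.fromSpecStalk (ℓ ξ))) := by
      rw [e]; infer_instance
    infer_instance
  -- `Spec K(X) → Spec 𝒪_{X',ℓ ξ}` is flat, surjective and quasi-compact (a map of fields)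
  letI : Field (X'.presheaf.stalk (ℓ ξ)) := hF.toField
  letI : Algebra (X'.presheaf.stalk (ℓ ξ)) (X.presheaf.stalk ξ) := φ.hom.toAlgebra
  haveI : Flat (Spec.map φ) := by
    rw [show φ = CommRingCat.ofHom (algebraMap (X'.presheaf.stalk (ℓ ξ)) (X.presheaf.stalk ξ))
      from rfl, Flat.SpecMap_iff, CommRingCat.hom_ofHom]
    exact RingHom.flat_algebraMap_iff.mpr inferInstance
  haveI : Surjective (Spec.map φ) := by
    haveI : Subsingleton ↥(Spec (X'.presheaf.stalk (ℓ ξ))) :=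
      inferInstanceAs (Subsingleton (PrimeSpectrum (X'.presheaf.stalk (ℓ ξ))))
    haveI : Nonempty ↥(Spec (X.presheaf.stalk ξ)) :=
      inferInstanceAs (Nonempty (PrimeSpectrum (X.presheaf.stalk ξ)))
    infer_instance
  exact MorphismProperty.of_pullback_snd_of_descendsAlong
    (P := MorphismProperty.isomorphisms Scheme.{0}) (Q := @Surjective ⊓ @Flat ⊓ @QuasiCompact)
    (f := pullback.snd G (X'.fromSpecStalk (ℓ ξ))) (g := Spec.map φ)
    ⟨⟨inferInstance, inferInstance⟩, inferInstance⟩ h3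

/-- **An isomorphism at the generic point spreads to a dense open** (EGA IV₃ 8.8.2.5 / Görtz–Wedhorn
I, Cor. 10.64 (2), through the tree's `Limits.LocApprox.exists_pullback_iso_of_pullback_iso`): let
`X` be integral and `G : Y → X` quasi-compact, quasi-separated and locally of finite
presentation, whose base change along `Spec K(X) = Spec 𝒪_{X,ξ} → X` is an isomorphism. Then
`G` restricts to an isomorphism over some non-empty open `W ⊆ X`: over an affine open
`V = Spec A ∋ ξ`, `K(X) = Frac A = A_S` (`S = A ∖ 0`), the `A`-schemes `G⁻¹(V)` and `V` become
isomorphic over `Spec A_S`, hence over some `D(t) = Spec A[1/t]`, `t ≠ 0`.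
[cite: GortzWedhorn2020, Cor. 10.64 (2)] -/
theorem exists_isIso_morphismRestrict_of_isIso_pullback_snd_fromSpecStalk {Y X : Scheme.{0}}
    [IsIntegral X] (G : Y ⟶ X) [QuasiCompact G] [QuasiSeparated G]
    [LocallyOfFinitePresentation G] {x : X} (hx : x = genericPoint X)
    [hiso : IsIso (pullback.snd G (X.fromSpecStalk x))] :
    ∃ W : X.Opens, (W : Set X).Nonempty ∧ IsIso (G ∣_ W) := by
  classical
  subst hx
  set ξ := genericPoint X with hξ
  -- an affine open `V ∋ ξ`, `A = Γ(X, V)`, `K(X) = Frac A`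
  obtain ⟨_, ⟨V, hV, rfl⟩, hξV, -⟩ :=
    X.isBasis_affineOpens.exists_subset_of_mem_open (Set.mem_univ ξ) isOpen_univ
  haveI : Nonempty V := ⟨⟨ξ, hξV⟩⟩
  let A : Type := Γ(X, V)
  let B : Type := X.functionField
  haveI : IsFractionRing A B := functionField_isFractionRing_of_isAffineOpen X V hV
  -- the two `A`-schemes `G⁻¹(V) → Spec A` and `Spec A`
  let P₁ : Literature.AlgebraicGeometry.Motives.SchemeOver A := Over.mk (pullback.snd G hV.fromSpec)
  let P₂ : Literature.AlgebraicGeometry.Motives.SchemeOver A := Over.mk (𝟙 (Spec (.of A)))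
  haveI : QuasiCompact P₁.hom := inferInstanceAs (QuasiCompact (pullback.snd G hV.fromSpec))
  haveI : QuasiSeparated P₁.hom := inferInstanceAs (QuasiSeparated (pullback.snd G hV.fromSpec))
  haveI : LocallyOfFinitePresentation P₁.hom :=
    inferInstanceAs (LocallyOfFinitePresentation (pullback.snd G hV.fromSpec))
  haveI : QuasiCompact P₂.hom := inferInstanceAs (QuasiCompact (𝟙 _))
  haveI : QuasiSeparated P₂.hom := inferInstanceAs (QuasiSeparated (𝟙 _))
  haveI : LocallyOfFinitePresentation P₂.hom := inferInstanceAs (LocallyOfFinitePresentation (𝟙 _))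
  -- `Spec K(X) → Spec A → X` is `Spec 𝒪_{X,ξ} → X`
  have hgen : Spec.map (CommRingCat.ofHom (algebraMap A B)) ≫ hV.fromSpec = X.fromSpecStalk ξ := by
    rw [← hV.fromSpecStalk_eq_fromSpecStalk hξV, IsAffineOpen.fromSpecStalk]
    rfl
  -- over `Spec K(X)` both become isomorphic (to `Spec K(X)`)
  haveI h1 : IsIso (pullback.snd P₁.hom (Spec.map (CommRingCat.ofHom (algebraMap A B)))) := by
    change IsIso (pullback.snd (pullback.snd G hV.fromSpec) (Spec.map (CommRingCat.ofHom (algebraMap A B))))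
    rw [← pullbackLeftPullbackSndIso_hom_snd G hV.fromSpec]
    have e : pullback.snd G (Spec.map (CommRingCat.ofHom (algebraMap A B)) ≫ hV.fromSpec) =
        (pullback.congrHom rfl hgen).hom ≫ pullback.snd G (X.fromSpecStalk ξ) := by
      rw [pullback.congrHom_hom, pullback.lift_snd, Category.comp_id]
    haveI : IsIso (pullback.snd G (Spec.map (CommRingCat.ofHom (algebraMap A B)) ≫ hV.fromSpec)) := by
      rw [e]; infer_instance
    infer_instance
  haveI h2 : IsIso (pullback.snd P₂.hom (Spec.map (CommRingCat.ofHom (algebraMap A B)))) :=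
    inferInstanceAs (IsIso (pullback.snd (𝟙 _) (Spec.map (CommRingCat.ofHom (algebraMap A B)))))
  let k : (Over.pullback (Literature.AlgebraicGeometry.Motives.specOver A B).hom).obj P₁ ≅
      (Over.pullback (Literature.AlgebraicGeometry.Motives.specOver A B).hom).obj P₂ :=
    Over.isoMk (@asIso _ _ _ _ (pullback.snd P₁.hom (Spec.map (CommRingCat.ofHom (algebraMap A B)))) h1 ≪≫
      (@asIso _ _ _ _ (pullback.snd P₂.hom (Spec.map (CommRingCat.ofHom (algebraMap A B)))) h2).symm) (by
        show (pullback.snd P₁.hom (Spec.map (CommRingCat.ofHom (algebraMap A B))) ≫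
            inv (pullback.snd P₂.hom (Spec.map (CommRingCat.ofHom (algebraMap A B))))) ≫
            pullback.snd P₂.hom (Spec.map (CommRingCat.ofHom (algebraMap A B))) =
          pullback.snd P₁.hom (Spec.map (CommRingCat.ofHom (algebraMap A B)))
        rw [Category.assoc, @IsIso.inv_hom_id _ _ _ _ _ h2, Category.comp_id])
  -- hence over some `D(t)`, `t ≠ 0`
  obtain ⟨t, ⟨e⟩⟩ := Literature.AlgebraicGeometry.Limits.LocApprox.exists_pullback_iso_of_pullback_iso
    (S := nonZeroDivisors A) (B := B) k
  let T : Type := Localization.Away t.val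
  let i : Spec (.of T) ⟶ Spec (.of A) := Spec.map (CommRingCat.ofHom (algebraMap A T))
  have hi : ((Literature.AlgebraicGeometry.Limits.LocApprox.baseDiagram (nonZeroDivisors A)).obj t).hom = i := rfl
  haveI : IsIso (pullback.snd P₂.hom i) := inferInstanceAs (IsIso (pullback.snd (𝟙 _) i))
  have h3 : IsIso (pullback.snd (pullback.snd G hV.fromSpec) i) := by
    have w := Over.w e.hom
    haveI : IsIso e.hom.left := ((Over.forget _).mapIso e).isIso_hom
    haveI : IsIso ((Over.pullback ((Literature.AlgebraicGeometry.Limits.LocApprox.baseDiagram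
        (nonZeroDivisors A)).obj t).hom).obj P₂).hom :=
      inferInstanceAs (IsIso (pullback.snd (𝟙 _) i))
    change IsIso ((Over.pullback ((Literature.AlgebraicGeometry.Limits.LocApprox.baseDiagram
        (nonZeroDivisors A)).obj t).hom).obj P₁).hom
    rw [← w]
    infer_instance
  -- i.e. `G` is an isomorphism over the open `W = D(t) ⊆ V ⊆ X`
  haveI : IsOpenImmersion i := IsOpenImmersion.of_isLocalization t.val
  let j : Spec (.of T) ⟶ X := i ≫ hV.fromSpec
  haveI : IsIso (pullback.snd G j) := by
    change IsIso (pullback.snd G (i ≫ hV.fromSpec))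
    rw [← pullbackLeftPullbackSndIso_inv_snd_snd G hV.fromSpec i]
    infer_instance
  refine ⟨j.opensRange, ?_, ?_⟩
  · -- `D(t) ≠ ∅` as `t ≠ 0` in the domain `A`
    haveI : IsDomain A := inferInstance
    have ht : t.val ≠ 0 := nonZeroDivisors.ne_zero t.mem
    haveI : IsDomain T := IsLocalization.isDomain_of_le_nonZeroDivisors (M := Submonoid.powers t.val) T
      (powers_le_nonZeroDivisors_of_noZeroDivisors ht)
    haveI : Nonempty ↥(Spec (CommRingCat.of T)) := inferInstanceAs (Nonempty (PrimeSpectrum T))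
    exact Set.range_nonempty _
  · exact ((MorphismProperty.isomorphisms Scheme.{0}).arrow_mk_iso_iff
      (morphismRestrictOpensRange G j)).mpr ‹IsIso (pullback.snd G j)›

/-! ## Closed points of a variety over an algebraically closed field -/

/-- **Rational closed points are dense** (Hilbert's Nullstellensatz): for `R` of finite type over
an algebraically closed field `K`, every non-empty open subset of `Spec R` contains a closed point
`𝔪` (`R` is Jacobson), and `K → R/𝔪` is bijective (Zariski's lemma: `R/𝔪` is finite over `K`).
[folklore] -/
theorem exists_isMaximal_mem_of_isOpen {K R : Type} [Field K] [IsAlgClosed K] [CommRing R]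
    [Algebra K R] [Algebra.FiniteType K R] {O : Set (PrimeSpectrum R)} (hO : IsOpen O)
    (hne : O.Nonempty) :
    ∃ x ∈ O, x.asIdeal.IsMaximal ∧ Function.Bijective (algebraMap K (R ⧸ x.asIdeal)) := by
  haveI : IsJacobsonRing R := isJacobsonRing_of_finiteType (A := K) (B := R)
  obtain ⟨x, hxO, hx⟩ := PrimeSpectrum.exists_isClosed_singleton_of_isJacobsonRing O hO hne
  have hmax : x.asIdeal.IsMaximal := (PrimeSpectrum.isClosed_singleton_iff_isMaximal x).mp hx
  refine ⟨x, hxO, hmax, ?_⟩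
  letI : Field (R ⧸ x.asIdeal) := Ideal.Quotient.field x.asIdeal
  haveI : Module.Finite K (R ⧸ x.asIdeal) :=
    finite_of_finite_type_of_isJacobsonRing K (R ⧸ x.asIdeal)
  exact IsAlgClosed.algebraMap_bijective_of_isIntegral (k := K) (K := R ⧸ x.asIdeal)

/-! ## Reduction to proper schemes (Nagata) -/

/-- **It suffices to resolve PROPER integral schemes**: if every integral `K`-scheme proper over
`K` has a resolution, then so does every integral separated `K`-scheme of finite type — embed it
as a dense open of a proper `K`-scheme (Nagata's compactification theorem, proved in the tree:
`Morphisms.NagataCompactification_holds`, with schematically dense image, so that the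
compactification of an integral scheme is integral) and restrict a resolution of the
compactification (`Scheme.HasResolution.of_isOpenImmersion`). [cite: Conrad2007, Thm. 4.1 and Remark 4.2] -/
theorem hasResolution_of_forall_proper (K : Type) [Field K]
    (h : ∀ (X : Scheme.{0}) (f : X ⟶ Spec (.of K)), IsProper f → IsIntegral X →
      Scheme.HasResolution X)
    (X : Scheme.{0}) (f : X ⟶ Spec (.of K)) [IsSeparated f] [LocallyOfFiniteType f]
    [QuasiCompact f] [IsIntegral X] : Scheme.HasResolution X := by
  obtain ⟨Xc, j, g, hj, hjd, hjsd, hg, hfac⟩ :=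
    Literature.AlgebraicGeometry.Morphisms.NagataCompactification.exists_dense
      Literature.AlgebraicGeometry.Morphisms.NagataCompactification_holds X (Spec (.of K)) f
  haveI := hj; haveI := hjd; haveI := hjsd; haveI := hg
  -- `j` is quasi-compact (`j ≫ g = f` is, `g` is separated)
  haveI : QuasiCompact (j ≫ g) := hfac ▸ inferInstance
  haveI : QuasiCompact j := .of_comp j g
  -- `Xc` is integral: reduced (schematic density) and irreducible (density)
  haveI : IsReduced Xc := IsSchemeTheoreticallyDominant.isReduced j
  haveI : IrreducibleSpace Xc := by
    have h1 : IsIrreducible (Set.range j) := by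
      rw [← Set.image_univ]
      exact (IrreducibleSpace.isIrreducible_univ X).image _ j.continuous.continuousOn
    have h2 := h1.closure
    rw [j.denseRange.closure_range] at h2
    exact (irreducibleSpace_def Xc).mpr h2
  haveI : IsIntegral Xc := isIntegral_of_irreducibleSpace_of_isReduced Xc
  exact (h Xc g hg inferInstance).of_isOpenImmersion j

end Summit.ResolutionOfSingularities.ResolutionOfSingularities.Theorems.PrimeModelTransfer

end
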